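import Mathlib.RepresentationTheory.Invariants
import Mathlib.LinearAlgebra.FiniteDimensional.Lemmas
import Summits.Ventures.HSemireg.EquivariantSigmaInvariants
import HarnessLib

/-!
# Venture HSemireg — taking `G`-invariants is EXACT when `|G|` is invertible
# (the linear-algebra core of «Ext in the equivariant category = invariants of Ext»)

HONEST FRAMING. Lean index of the computation cell `pub-hsemireg`, widening seat `w1-tw-1` (W1, «twisted sheaves on
gerbes over the CM anchors»), companion of `EquivariantSigmaInvariants.lean`. This file is ELEMENTARY LINEAR ALGEBRA (the
Reynolds / averaging operator of a finite group whose order is invertible in the coefficient ring — Maschke's trick;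
folklore, e.g. the `H¹(G, ·) = 0` half of [Grothendieck, Tôhoku 1957, Prop. 5.2.3-style statements] for finite groups in
characteristic prime to `|G|`). No gerbe, no sheaf, no Ext group and no semiregularity map is constructed here; nothing here
says that HC, HC_CM or HC_AV holds, and nothing here is a new case of anything.

*What it indexes (on paper, NOT in this file).* THEOREM TW-EQ (ii) of the seat note
`run/shared/lean/pub/pub-hsemireg/widen/W1/TW-EQ-w1tw1.md` says: for an `α`-twisted sheaf `E` on an abelian anchor `A₀`
presented as a free-Heisenberg-symmetric honest sheaf `N` on an isogenous cover `A₁` (group `G` of deck translations,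
`|G|` finite), `Extⁱ_α(E,E) = Extⁱ_{A₁}(N,N)^G`. Granting that `RHom` in the equivariant category is computed by the
`G`-INVARIANTS of an equivariant complex computing `RHom_{A₁}(N,N)` (descent, PLAN-W1-TW T-8 (a)), the identification of
COHOMOLOGY needs exactly one fact: over a ring in which `|G|` is invertible the functor `V ↦ V^G` is EXACT, so it commutes
with passing to the cohomology of a complex. That fact — and its hands-on corollaries («an invariant coboundary is the
coboundary of an invariant cochain», «a cocycle with invariant class is cohomologous to an invariant cocycle», «invariants of
a quotient representation are the image of the invariants») — is what is recorded below, for UNBUNDLED data: `k`-linear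
representations `ρU, ρV, ρW` of `G` and `k`-linear maps `f : U → V`, `g : V → W` with the equivariance hypothesis
`f ∘ ρU γ = ρV γ ∘ f` (Mathlib's `Representation.IntertwiningMap.isIntertwining'` shape).

CONTENT (all PROVED, 0 sorry, no definitions, no named facts), namespace `Summit.Ventures.HSemireg.InvariantsExact`:
* `apply_mem_invariants`, `map_invariants_le` — an equivariant map sends invariants to invariants (no hypothesis on `|G|`);
* `averageMap_comp`, `averageMap_apply` — the Reynolds projector is NATURAL: `R_V ∘ f = f ∘ R_U`;
* `exists_mem_invariants_map_eq`, `range_inf_invariants_eq_map_invariants` — **`range f ∩ V^G = f(U^G)`**: an invariant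
  vector that is an image is the image of an invariant vector («`H¹(G, ker f) = 0`» in disguise);
* `map_invariants_eq_of_surjective`, `invariants_quotient_eq_map` — **invariants of a quotient = image of the invariants**;
* `injective_restrict_invariants`, `surjective_restrict_invariants`, `exact_restrict_invariants` — **the functor of
  invariants preserves injections, surjections and exactness** (`Function.Exact`) of equivariant maps;
* `exists_mem_invariants_sub_mem_range` — a cocycle whose class is invariant (`ρ γ z − z` a coboundary for all `γ`) is
  cohomologous to an INVARIANT cocycle (namely `R z`), which is still a cocycle for any equivariant differential;
* over a field, finite-dimensional: `finrank_invariants_eq_of_exact` — **`dim V^G = dim U^G + dim W^G`** for a short exact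
  sequence `0 → U → V → W → 0` of representations (the cell's COUNT currency for invariant parts, e.g. DETTWIST's `e_k`).
Deliberately NOT here: the descent equivalence for a finite étale Galois cover and any statement about sheaves or `Ext`
(no carrier in the tree for twisted sheaves); those are the note's DERIVED-ELEMENTARY steps with the printed inputs listed in
its §12 ([Căldăraru 2000, Thm 1.3.7], [Mumford1966EquationsI, §1 Prop. 3], Berkovich 1972 via Brion 2013 Rem. 3.13).
-/

noncomputable section

open Representation

namespace Summit.Ventures.HSemireg

namespace InvariantsExact

variable {k G U V W : Type*} [CommRing k] [Group G]
variable [AddCommGroup U] [Module k U] [AddCommGroup V] [Module k V] [AddCommGroup W] [Module k W]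
variable {ρU : Representation k G U} {ρV : Representation k G V} {ρW : Representation k G W}
variable {f : U →ₗ[k] V} {g : V →ₗ[k] W}

/-! ### Equivariant maps preserve invariants (no hypothesis on `|G|`) -/

/-- An equivariant linear map sends `G`-invariant vectors to `G`-invariant vectors. Folklore. -/
theorem apply_mem_invariants (hf : ∀ γ : G, f ∘ₗ ρU γ = ρV γ ∘ₗ f) {u : U} (hu : u ∈ invariants ρU) :
    f u ∈ invariants ρV := by
  rw [mem_invariants] at hu ⊢
  intro γ
  have h := LinearMap.congr_fun (hf γ) u
  simp only [LinearMap.comp_apply] at h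
  rw [← h, hu γ]

/-- `f(U^G) ≤ V^G` for an equivariant `f`. Folklore. -/
theorem map_invariants_le (hf : ∀ γ : G, f ∘ₗ ρU γ = ρV γ ∘ₗ f) :
    (invariants ρU).map f ≤ invariants ρV := by
  rintro v ⟨u, hu, rfl⟩
  exact apply_mem_invariants hf hu

/-- The restriction `f^G : U^G → V^G` of an INJECTIVE equivariant map is injective (invariants are left exact — this half
needs no hypothesis on `|G|`). Folklore. -/
theorem injective_restrict_invariants (hf : ∀ γ : G, f ∘ₗ ρU γ = ρV γ ∘ₗ f) (hinj : Function.Injective f) :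
    Function.Injective (f.restrict fun _ hu => apply_mem_invariants hf hu) := by
  intro x y hxy
  apply Subtype.ext
  apply hinj
  have := congrArg Subtype.val hxy
  simpa [LinearMap.restrict_apply] using this

/-- Kernels commute with invariants: `u ∈ U^G` lies in the kernel of `f^G` iff it lies in `ker f` (left exactness, no
hypothesis on `|G|`). Folklore. -/
theorem restrict_invariants_apply_eq_zero_iff (hf : ∀ γ : G, f ∘ₗ ρU γ = ρV γ ∘ₗ f) (u : invariants ρU) :
    f.restrict (fun _ hu => apply_mem_invariants hf hu) u = 0 ↔ f u = 0 := by
  rw [LinearMap.restrict_apply, Submodule.mk_eq_zero]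

/-! ### The averaging argument (`|G|` invertible in `k`) -/

section Average

variable [Fintype G] [Invertible (Fintype.card G : k)]

/-- **Naturality of the Reynolds projector**: `R_V ∘ f = f ∘ R_U` for an equivariant `f`. Folklore. -/
theorem averageMap_comp (hf : ∀ γ : G, f ∘ₗ ρU γ = ρV γ ∘ₗ f) :
    ρV.averageMap ∘ₗ f = f ∘ₗ ρU.averageMap := by
  ext u
  simp only [LinearMap.comp_apply, EquivariantSigma.averageMap_apply_eq_sum, map_smul, map_sum]
  congr 1
  refine Finset.sum_congr rfl fun γ _ => ?_
  have h := LinearMap.congr_fun (hf γ) u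
  simp only [LinearMap.comp_apply] at h
  exact h.symm

/-- Pointwise naturality: `R_V (f u) = f (R_U u)`. Folklore. -/
theorem averageMap_apply (hf : ∀ γ : G, f ∘ₗ ρU γ = ρV γ ∘ₗ f) (u : U) :
    ρV.averageMap (f u) = f (ρU.averageMap u) :=
  LinearMap.congr_fun (averageMap_comp hf) u

/-- **`H¹ = 0` in disguise**: an INVARIANT vector lying in the range of an equivariant map is the image of an INVARIANT
vector (namely of the average of any preimage). Folklore (Maschke averaging). -/
theorem exists_mem_invariants_map_eq (hf : ∀ γ : G, f ∘ₗ ρU γ = ρV γ ∘ₗ f) {v : V} (hv : v ∈ invariants ρV)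
    (hv' : v ∈ LinearMap.range f) : ∃ u ∈ invariants ρU, f u = v := by
  obtain ⟨u, rfl⟩ := hv'
  exact ⟨ρU.averageMap u, ρU.averageMap_invariant u, by rw [← averageMap_apply hf, ρV.averageMap_id _ hv]⟩

/-- **`range f ∩ V^G = f(U^G)`** for an equivariant `f` when `|G|` is invertible. Folklore. -/
theorem range_inf_invariants_eq_map_invariants (hf : ∀ γ : G, f ∘ₗ ρU γ = ρV γ ∘ₗ f) :
    LinearMap.range f ⊓ invariants ρV = (invariants ρU).map f := by
  apply le_antisymm
  · rintro v ⟨hv', hv⟩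
    obtain ⟨u, hu, rfl⟩ := exists_mem_invariants_map_eq hf hv hv'
    exact ⟨u, hu, rfl⟩
  · exact le_inf LinearMap.map_le_range (map_invariants_le hf)

/-- **Invariants of a quotient, surjection form**: if `g : V → W` is equivariant and SURJECTIVE then `W^G = g(V^G)`.
Folklore. -/
theorem map_invariants_eq_of_surjective (hg : ∀ γ : G, g ∘ₗ ρV γ = ρW γ ∘ₗ g) (hsurj : Function.Surjective g) :
    (invariants ρV).map g = invariants ρW := by
  rw [← range_inf_invariants_eq_map_invariants hg, LinearMap.range_eq_top.mpr hsurj, top_inf_eq]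

/-- **Invariants of a quotient representation** `V ⧸ W'` (Mathlib's `Representation.quotient`) are the image of the
invariants of `V`: `(V ⧸ W')^G = (V^G + W')/W'`. Folklore («`H¹(G, W') = 0`»). -/
theorem invariants_quotient_eq_map (W' : Submodule k V) (hW : ∀ γ : G, W' ≤ W'.comap (ρV γ)) :
    invariants (ρV.quotient W' hW) = (invariants ρV).map W'.mkQ := by
  symm
  apply map_invariants_eq_of_surjective (ρV := ρV) (ρW := ρV.quotient W' hW) (g := W'.mkQ)
  · intro γ
    ext v
    rfl
  · exact Submodule.mkQ_surjective W'

/-- The restriction `g^G : V^G → W^G` of a SURJECTIVE equivariant map is surjective when `|G|` is invertible (right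
exactness of invariants). Folklore. -/
theorem surjective_restrict_invariants (hg : ∀ γ : G, g ∘ₗ ρV γ = ρW γ ∘ₗ g) (hsurj : Function.Surjective g) :
    Function.Surjective (g.restrict fun _ hv => apply_mem_invariants hg hv) := by
  rintro ⟨w, hw⟩
  obtain ⟨v, hv, hvw⟩ := exists_mem_invariants_map_eq hg hw (hsurj w)
  exact ⟨⟨v, hv⟩, Subtype.ext (by simpa [LinearMap.restrict_apply] using hvw)⟩

/-- **Exactness of invariants**: if `U → V → W` is an exact pair of equivariant maps (`ker g = range f`) then so is
`U^G → V^G → W^G`, provided `|G|` is invertible in `k`. Folklore (Maschke / `H¹(G, ·) = 0` for such `G`). -/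
theorem exact_restrict_invariants (hf : ∀ γ : G, f ∘ₗ ρU γ = ρV γ ∘ₗ f) (hg : ∀ γ : G, g ∘ₗ ρV γ = ρW γ ∘ₗ g)
    (hfg : Function.Exact f g) :
    Function.Exact (f.restrict fun _ hu => apply_mem_invariants hf hu)
      (g.restrict fun _ hv => apply_mem_invariants hg hv) := by
  rintro ⟨v, hv⟩
  rw [restrict_invariants_apply_eq_zero_iff hg]
  constructor
  · intro hv0
    have hvr : v ∈ LinearMap.range f := by
      rw [← hfg.linearMap_ker_eq]
      exact hv0
    obtain ⟨u, hu, huv⟩ := exists_mem_invariants_map_eq hf hv hvr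
    exact ⟨⟨u, hu⟩, Subtype.ext (by simpa [LinearMap.restrict_apply] using huv)⟩
  · rintro ⟨⟨u, hu⟩, huv⟩
    have huv' : f u = v := by simpa [LinearMap.restrict_apply] using congrArg Subtype.val huv
    show g v = 0
    rw [← huv']
    exact (hfg (f u)).mpr ⟨u, rfl⟩

/-- **Invariant classes have invariant representatives.** Let `e : C⁰ → C¹` be any linear map (a «coboundary» map; its
equivariance is not even needed here) and let `z ∈ C¹` have a `G`-INVARIANT class modulo `range e`, i.e.
`ρ γ z − z ∈ range e` for every `γ`. Then `z` is congruent modulo `range e` to the INVARIANT vector `R z`. (With `range_inf_invariants_eq_map_invariants` this is the statement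
`H(C^G) = H(C)^G` for a `G`-complex.) Folklore. -/
theorem averageMap_sub_mem_range (f : U →ₗ[k] V) {z : V}
    (hz : ∀ γ : G, ρV γ z - z ∈ LinearMap.range f) : ρV.averageMap z - z ∈ LinearMap.range f := by
  have hsum : ∑ γ : G, (ρV γ z - z) ∈ LinearMap.range f := Submodule.sum_mem _ fun γ _ => hz γ
  have key : ρV.averageMap z - z = ⅟(Fintype.card G : k) • ∑ γ : G, (ρV γ z - z) := by
    rw [EquivariantSigma.averageMap_apply_eq_sum, Finset.sum_sub_distrib, Finset.sum_const, Finset.card_univ,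
      smul_sub, ← Nat.cast_smul_eq_nsmul k, smul_smul, invOf_mul_self, one_smul]
  rw [key]
  exact Submodule.smul_mem _ _ hsum

/-- Same, packaged: there is an invariant `z'` with `z' − z ∈ range e`; if moreover `d z = 0` for an equivariant
`d : C¹ → C²` then `d z' = 0` as well (`z' = R z`). Folklore. -/
theorem exists_mem_invariants_sub_mem_range (f : U →ₗ[k] V)
    (hd : ∀ γ : G, g ∘ₗ ρV γ = ρW γ ∘ₗ g) {z : V} (hz : ∀ γ : G, ρV γ z - z ∈ LinearMap.range f) (hdz : g z = 0) :
    ∃ z' ∈ invariants ρV, z' - z ∈ LinearMap.range f ∧ g z' = 0 :=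
  ⟨ρV.averageMap z, ρV.averageMap_invariant z, averageMap_sub_mem_range f hz,
    by rw [← averageMap_apply hd, hdz, map_zero]⟩

end Average

end InvariantsExact

namespace InvariantsExact

/-! ### Dimension bookkeeping over a field (the cell's COUNT currency for invariant parts) -/

variable {k G U V W : Type*} [Field k] [Group G]
variable [AddCommGroup U] [Module k U] [AddCommGroup V] [Module k V] [AddCommGroup W] [Module k W]
variable {ρU : Representation k G U} {ρV : Representation k G V} {ρW : Representation k G W}
variable {f : U →ₗ[k] V} {g : V →ₗ[k] W}
variable [Fintype G] [Invertible (Fintype.card G : k)]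

/-- **`dim V^G = dim U^G + dim W^G`** for a short exact sequence `0 → U → V → W → 0` of finite-dimensional
representations over a field in which `|G|` is invertible. Folklore (exactness of invariants + rank–nullity). -/
theorem finrank_invariants_eq_of_exact [FiniteDimensional k V] (hf : ∀ γ : G, f ∘ₗ ρU γ = ρV γ ∘ₗ f)
    (hg : ∀ γ : G, g ∘ₗ ρV γ = ρW γ ∘ₗ g) (hfg : Function.Exact f g) (hinj : Function.Injective f)
    (hsurj : Function.Surjective g) :
    Module.finrank k (invariants ρV) =
      Module.finrank k (invariants ρU) + Module.finrank k (invariants ρW) := by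
  set fG := f.restrict (p := invariants ρU) (q := invariants ρV) fun _ hu => apply_mem_invariants hf hu with hfG
  set gG := g.restrict (p := invariants ρV) (q := invariants ρW) fun _ hv => apply_mem_invariants hg hv with hgG
  have hex : Function.Exact fG gG := exact_restrict_invariants hf hg hfg
  have h1 := LinearMap.finrank_range_add_finrank_ker gG
  have h2 : LinearMap.range gG = ⊤ := LinearMap.range_eq_top.mpr (surjective_restrict_invariants hg hsurj)
  have h3 : LinearMap.ker gG = LinearMap.range fG := hex.linearMap_ker_eq
  have h4 : Module.finrank k (LinearMap.range fG) = Module.finrank k (invariants ρU) :=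
    LinearMap.finrank_range_of_inj (injective_restrict_invariants hf hinj)
  rw [h2, finrank_top, h3, h4] at h1
  omega

end InvariantsExact

end Summit.Ventures.HSemireg

end
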